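import Literature.Analysis.PDE.AnalyticPropagationOfSmallness
import Literature.Analysis.PDE.AnalyticPropagationOfSmallnessChain
import Literature.Analysis.Calculus.AnalyticOfFDerivBound
import Mathlib.Analysis.InnerProductSpace.PiL2
import Mathlib.MeasureTheory.Measure.Lebesgue.EqHaar
import Mathlib.MeasureTheory.Integral.Bochner.Set
import HarnessLib

/-!
# Propagation of smallness for real-analytic functions from measurable sets — PROOF of the named fact

`Literature.Analysis.PDE.analyticPropagationOfSmallness n` (Apraiz–Escauriaza–Wang–Zhang 2014,
Thm 4 / Vessella 1999, operator-norm form on `EuclideanSpace ℝ (Fin n)`) HOLDS for every `n`.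

Proof (elementary, not the Carleman route of the paper): (1) Markov sub-selection — half of `E`
in measure lies where `|f| ≤ 2⨍_E|f|`; (2) for the target point `x ∈ B_R`, polar slicing about `x`
(Brudnyi–Ganzburg ray comparison `CarberyWright.measure_le_of_raySlice_bound`, in the tree) gives a
chord `[x, x + Lθ]` of the closed ball on which that set has linear density `≥ s/(8n)`; (3) along
the chord, `t ↦ f(x + tθ)` has the factorial derivative bounds (`norm_iteratedDeriv_comp_line_le`)
and the one-dimensional propagation `AnalyticSmallness.exists_oneDim_propagation` (Taylor + weak
Remez + chain) bounds `|f x|`.  Dimension `0` is trivial.  Theorems only; constants not optimised.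
-/

noncomputable section

open Set MeasureTheory Metric Real Filter Topology

namespace Literature.Analysis.PDE

namespace AnalyticSmallness

/-- **Markov sub-selection**: for `E` of finite measure and `f` integrable on `E`, the part of `E`
where `|f| ≤ 2 (∫_E |f|)/|E|` has at least half the measure of `E`. [folklore] -/
private theorem toReal_le_two_mul_sublevel {X : Type*} [MeasurableSpace X] (μ : Measure X) {E : Set X}
    (hEfin : μ E ≠ ⊤) {f : X → ℝ} (hf : Measurable f) (hfi : IntegrableOn f E μ) :
    (μ E).toReal ≤
      2 * (μ (E ∩ {y | |f y| ≤ 2 * ((∫ y in E, |f y| ∂μ) / (μ E).toReal)})).toReal := by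
  set A := (∫ y in E, |f y| ∂μ) / (μ E).toReal with hA
  have hfa : Measurable fun y => |f y| := continuous_abs.measurable.comp hf
  have hT : MeasurableSet {y | |f y| ≤ 2 * A} := measurableSet_le hfa measurable_const
  have hT' : MeasurableSet {y | 2 * A < |f y|} := measurableSet_lt measurable_const hfa
  have hT'' : MeasurableSet {y | 2 * A ≤ |f y|} := measurableSet_le measurable_const hfa
  have hfin1 : μ (E ∩ {y | |f y| ≤ 2 * A}) ≠ ⊤ := measure_ne_top_of_subset inter_subset_left hEfin
  have hfin2 : μ (E ∩ {y | 2 * A < |f y|}) ≠ ⊤ := measure_ne_top_of_subset inter_subset_left hEfin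
  have hcover : E ⊆ (E ∩ {y | |f y| ≤ 2 * A}) ∪ (E ∩ {y | 2 * A < |f y|}) := fun y hy =>
    (le_or_gt |f y| (2 * A)).elim (fun h => Or.inl ⟨hy, h⟩) (fun h => Or.inr ⟨hy, h⟩)
  have hsum : (μ E).toReal ≤
      (μ (E ∩ {y | |f y| ≤ 2 * A})).toReal + (μ (E ∩ {y | 2 * A < |f y|})).toReal := by
    rw [← ENNReal.toReal_add hfin1 hfin2]
    exact ENNReal.toReal_mono (ENNReal.add_ne_top.2 ⟨hfin1, hfin2⟩)
      ((measure_mono hcover).trans (measure_union_le _ _))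
  have hnonneg : 0 ≤ᵐ[μ.restrict E] fun y => |f y| := ae_of_all _ fun y => abs_nonneg _
  have hint : Integrable (fun y => |f y|) (μ.restrict E) := hfi.abs
  -- the exceptional part has at most half the measure
  have hhalf : (μ (E ∩ {y | 2 * A < |f y|})).toReal ≤ (μ E).toReal / 2 := by
    by_cases h0 : ∫ y in E, |f y| ∂μ = 0
    · have hae := (integral_eq_zero_iff_of_nonneg_ae hnonneg hint).1 h0
      have hA0 : A = 0 := by rw [hA, h0, zero_div]
      have hnull : μ (E ∩ {y | 2 * A < |f y|}) = 0 := by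
        rw [inter_comm, ← Measure.restrict_apply hT', measure_eq_zero_iff_ae_notMem]
        filter_upwards [hae] with y hy
        simp only [Pi.zero_apply] at hy
        simp [hA0, hy]
      rw [hnull, ENNReal.toReal_zero]
      positivity
    · have hIpos : 0 < ∫ y in E, |f y| ∂μ :=
        lt_of_le_of_ne (integral_nonneg fun y => abs_nonneg _) (Ne.symm h0)
      have hEpos : 0 < (μ E).toReal := by
        rcases (ENNReal.toReal_nonneg : 0 ≤ (μ E).toReal).eq_or_lt with h | h
        · exfalso
          have hE0 : μ E = 0 := by
            rcases (ENNReal.toReal_eq_zero_iff _).1 h.symm with h' | h'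
            · exact h'
            · exact absurd h' hEfin
          have : ∫ y in E, |f y| ∂μ = 0 := setIntegral_measure_zero _ hE0
          exact h0 this
        · exact h
      have hIA : ∫ y in E, |f y| ∂μ = A * (μ E).toReal := by
        rw [hA, div_mul_cancel₀ _ hEpos.ne']
      have hmarkov := mul_meas_ge_le_integral_of_nonneg hnonneg hint (2 * A)
      rw [measureReal_def, Measure.restrict_apply hT'', hIA] at hmarkov
      have hApos : 0 < A := div_pos hIpos hEpos
      have h1 : (μ ({y | 2 * A ≤ |f y|} ∩ E)).toReal ≤ (μ E).toReal / 2 := by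
        rw [le_div_iff₀ (by norm_num : (0:ℝ) < 2)]
        nlinarith
      have h2 : μ (E ∩ {y | 2 * A < |f y|}) ≤ μ ({y | 2 * A ≤ |f y|} ∩ E) :=
        measure_mono fun y hy => ⟨show 2 * A ≤ |f y| from le_of_lt hy.2, hy.1⟩
      exact (ENNReal.toReal_mono (measure_ne_top_of_subset inter_subset_right hEfin) h2).trans h1
  linarith

/-- The propagation-of-smallness fact in positive dimension. [folklore] -/
private theorem analyticPropagationOfSmallness_of_pos {n : ℕ} (hn : 0 < n) :
    analyticPropagationOfSmallness n := by
  intro ρ s hρ hρ1 hs hs1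
  haveI : Nontrivial (EuclideanSpace ℝ (Fin n)) :=
    Module.nontrivial_of_finrank_pos (R := ℝ) (by rw [finrank_euclideanSpace_fin]; exact hn)
  have hnR : (0 : ℝ) < n := by exact_mod_cast hn
  have hκ : 0 < s / (4 * n) := by positivity
  have hκ1 : s / (4 * n) ≤ 1 := by
    rw [div_le_one (by positivity)]
    have : (1 : ℝ) ≤ n := by exact_mod_cast hn
    nlinarith
  obtain ⟨N, θ, hN, hθ, hθ1, h1d⟩ := exists_oneDim_propagation hκ hκ1 (half_pos hρ)
  refine ⟨2 * N, θ, by positivity, hθ, hθ1, ?_⟩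
  intro f x₀ R M hR hM hf hD E hE hEsub hvol x hx
  -- volumes (all finite and positive), in real form
  have hVpos : 0 < volume (ball x₀ R) := measure_ball_pos _ _ hR
  have hVlt : volume (ball x₀ R) < ⊤ := measure_ball_lt_top
  have hVR : 0 < (volume (ball x₀ R)).toReal := ENNReal.toReal_pos hVpos.ne' hVlt.ne
  have hElt : volume E < ⊤ := lt_of_le_of_lt (measure_mono hEsub) hVlt
  set A := (∫ y in E, |f y|) / (volume E).toReal with hA
  have hA0 : 0 ≤ A := div_nonneg (integral_nonneg fun _ => abs_nonneg _) ENNReal.toReal_nonneg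
  -- (1) Markov sub-selection
  set E' := E ∩ {y | |f y| ≤ 2 * A} with hE'
  have hE'meas : MeasurableSet E' :=
    hE.inter (measurableSet_le (continuous_abs.measurable.comp hf.continuous.measurable)
      measurable_const)
  have hE'sub : E' ⊆ E := inter_subset_left
  have hfi : IntegrableOn f E volume := by
    have hK : IntegrableOn f (closedBall x₀ R) volume :=
      hf.continuous.continuousOn.integrableOn_compact (isCompact_closedBall _ _)
    exact hK.mono_set (hEsub.trans ball_subset_closedBall)
  have hmarkov : (volume E).toReal ≤ 2 * (volume E').toReal :=
    toReal_le_two_mul_sublevel volume hElt.ne hf.continuous.measurable hfi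
  -- (2) the chord through `x`
  set K := closedBall x₀ R with hK
  have hxK : x ∈ K := ball_subset_closedBall hx
  have hKc : IsCompact K := isCompact_closedBall _ _
  have hKconv : Convex ℝ K := convex_closedBall _ _
  have hE'K : E' ⊆ K := hE'sub.trans (hEsub.trans ball_subset_closedBall)
  choose L hL0 hLK hKL using fun θ : sphere (0 : EuclideanSpace ℝ (Fin n)) 1 =>
    Literature.Analysis.Approximation.CarberyWright.exists_rayLength hKc hKconv hxK
      (θ : EuclideanSpace ℝ (Fin n)) (by simp)
  have hray : ∃ θ : sphere (0 : EuclideanSpace ℝ (Fin n)) 1,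
      ENNReal.ofReal (s / (4 * n) * L θ) <
        volume {r : ℝ | 0 < r ∧ x + r • (θ : EuclideanSpace ℝ (Fin n)) ∈ E'} := by
    by_contra hall
    push Not at hall
    have hle := Literature.Analysis.Approximation.CarberyWright.measure_le_of_raySlice_bound
      volume isClosed_closedBall.measurableSet hE'meas hE'K x L hL0 hLK hKL hκ.le hall
    rw [finrank_euclideanSpace_fin, Measure.addHaar_closedBall_eq_addHaar_ball] at hle
    have hnκ : (n : ℝ) * (s / (4 * n)) = s / 4 := by field_simp
    rw [hnκ] at hle
    have hle' : (volume E').toReal ≤ s / 4 * (volume (ball x₀ R)).toReal := by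
      have := ENNReal.toReal_mono (ENNReal.mul_ne_top ENNReal.ofReal_ne_top hVlt.ne) hle
      rwa [ENNReal.toReal_mul, ENNReal.toReal_ofReal (by positivity)] at this
    nlinarith
  obtain ⟨ω, hω⟩ := hray
  -- the chord has positive length `≤ 2R`
  have hLpos : 0 < L ω := by
    by_contra hle
    push Not at hle
    have hempty : {r : ℝ | 0 < r ∧ x + r • (ω : EuclideanSpace ℝ (Fin n)) ∈ E'} = ∅ := by
      ext r
      simp only [mem_setOf_eq, mem_empty_iff_false, iff_false, not_and]
      intro hr hmem
      have := hLK ω r hr (hE'K hmem)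
      linarith
    rw [hempty, measure_empty] at hω
    exact ENNReal.not_lt_zero hω
  have hL2R : L ω ≤ 2 * R := by
    by_contra h
    push Not at h
    have hmem := hKL ω (2 * R) (by positivity) h
    have hω1 : ‖(ω : EuclideanSpace ℝ (Fin n))‖ = 1 := by simp
    have h1 : dist (x + (2 * R) • (ω : EuclideanSpace ℝ (Fin n))) x = 2 * R := by
      rw [dist_eq_norm, add_sub_cancel_left, norm_smul, hω1, mul_one, Real.norm_eq_abs,
        abs_of_pos (by positivity)]
    have h2 : dist (x + (2 * R) • (ω : EuclideanSpace ℝ (Fin n))) x ≤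
        dist (x + (2 * R) • (ω : EuclideanSpace ℝ (Fin n))) x₀ + dist x₀ x := dist_triangle _ _ _
    have h3 : dist (x + (2 * R) • (ω : EuclideanSpace ℝ (Fin n))) x₀ ≤ R := mem_closedBall.1 hmem
    have h4 : dist x₀ x < R := by rw [dist_comm]; exact mem_ball.1 hx
    linarith
  -- the whole closed chord lies in `K ⊆ B(x₀, 2R)`
  have hcont : Continuous fun t : ℝ => x + t • (ω : EuclideanSpace ℝ (Fin n)) := by fun_prop
  have hsegK : ∀ t ∈ Icc (0:ℝ) (L ω), x + t • (ω : EuclideanSpace ℝ (Fin n)) ∈ K := by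
    intro t ht
    rcases ht.1.eq_or_lt with h0 | htpos
    · rw [← h0, zero_smul, add_zero]; exact hxK
    rcases ht.2.lt_or_eq with htL | htL
    · exact hKL ω t htpos htL
    · rw [htL]
      have hev : ∀ᶠ u in 𝓝[<] (L ω), x + u • (ω : EuclideanSpace ℝ (Fin n)) ∈ K :=
        mem_of_superset (Ioo_mem_nhdsLT hLpos) fun u hu => hKL ω u hu.1 hu.2
      exact isClosed_closedBall.mem_of_tendsto
        ((hcont.tendsto (L ω)).mono_left nhdsWithin_le_nhds) hev
  have hseg2R : ∀ t ∈ Icc (0:ℝ) (L ω),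
      x + t • (ω : EuclideanSpace ℝ (Fin n)) ∈ ball x₀ (2 * R) := fun t ht =>
    closedBall_subset_ball (by linarith) (hsegK t ht)
  -- (3) the one-dimensional function along the chord
  set g : ℝ → ℝ := fun t => f (x + t • (ω : EuclideanSpace ℝ (Fin n))) with hg
  have hgc : ContDiff ℝ (⊤ : ℕ∞) g := hf.comp (contDiff_const.add (contDiff_id.smul contDiff_const))
  have hDg : ∀ (k : ℕ), ∀ t ∈ Icc (0:ℝ) (L ω),
      |iteratedDeriv k g t| ≤ M * (k.factorial : ℝ) / (ρ * R) ^ k := by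
    intro k t ht
    have h1 := Literature.Analysis.Calculus.norm_iteratedDeriv_comp_line_le isOpen_univ
      hf.contDiffOn x (ω : EuclideanSpace ℝ (Fin n)) (mem_univ _) k (t := t)
    have hω1 : ‖(ω : EuclideanSpace ℝ (Fin n))‖ = 1 := by simp
    rw [hω1, one_pow, mul_one, Real.norm_eq_abs] at h1
    exact h1.trans (hD k _ (hseg2R t ht))
  set S := {r : ℝ | 0 < r ∧ x + r • (ω : EuclideanSpace ℝ (Fin n)) ∈ E'} with hS
  have hSsub : S ⊆ Icc 0 (L ω) := fun r hr => ⟨hr.1.le, hLK ω r hr.1 (hE'K hr.2)⟩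
  have hSvol : ENNReal.ofReal (s / (4 * n) * (L ω - 0)) ≤ volume S := by
    rw [sub_zero]; exact hω.le
  have hB : ∀ r ∈ S, |g r| ≤ 2 * A := fun r hr => hr.2.2
  have hrR : ρ / 2 * (L ω - 0) ≤ ρ * R := by nlinarith
  have key := h1d g 0 (L ω) M (ρ * R) hgc hLpos hM hrR hDg S hSsub hSvol (2 * A) (by positivity) hB
    0 ⟨le_rfl, hLpos.le⟩
  have hg0 : g 0 = f x := by simp [hg]
  rw [hg0] at key
  have h2θ : (2 * A) ^ θ ≤ 2 * A ^ θ := by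
    rw [Real.mul_rpow (by norm_num) hA0]
    apply mul_le_mul_of_nonneg_right _ (by positivity)
    calc (2:ℝ) ^ θ ≤ (2:ℝ) ^ (1:ℝ) := Real.rpow_le_rpow_of_exponent_le (by norm_num) hθ1
      _ = 2 := Real.rpow_one 2
  calc |f x| ≤ N * (2 * A) ^ θ * M ^ (1 - θ) := key
    _ ≤ N * (2 * A ^ θ) * M ^ (1 - θ) := by gcongr
    _ = 2 * N * A ^ θ * M ^ (1 - θ) := by ring

/-- The propagation-of-smallness fact in dimension `0` (a one-point space: `θ = 1`, `N = 1`).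
[folklore] -/
private theorem analyticPropagationOfSmallness_zero : analyticPropagationOfSmallness 0 := by
  intro ρ s hρ hρ1 hs hs1
  refine ⟨1, 1, one_pos, one_pos, le_rfl, ?_⟩
  intro f x₀ R M hR hM hf hD E hE hEsub hvol x hx
  haveI : Subsingleton (EuclideanSpace ℝ (Fin 0)) :=
    Module.finrank_zero_iff.1 (finrank_euclideanSpace_fin (𝕜 := ℝ) (n := 0))
  have hVpos : 0 < volume (ball x₀ R) := measure_ball_pos _ _ hR
  have hVlt : volume (ball x₀ R) < ⊤ := measure_ball_lt_top
  have hVR : 0 < (volume (ball x₀ R)).toReal := ENNReal.toReal_pos hVpos.ne' hVlt.ne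
  have hEpos : 0 < (volume E).toReal := lt_of_lt_of_le (mul_pos hs hVR) hvol
  have hconst : ∀ y, |f y| = |f x| := fun y => by rw [Subsingleton.elim y x]
  have hint : ∫ y in E, |f y| = |f x| * (volume E).toReal := by
    simp_rw [hconst]
    rw [setIntegral_const, smul_eq_mul, measureReal_def, mul_comm]
  rw [hint, Real.rpow_one, sub_self, Real.rpow_zero, mul_one, one_mul, mul_div_assoc,
    div_self hEpos.ne', mul_one]

end AnalyticSmallness

/-- **Propagation of smallness for real-analytic functions from measurable sets** — the named
fact `analyticPropagationOfSmallness n` is a THEOREM of the tree, for every dimension `n`.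
[cite: ApraizEscauriazaWangZhang2014, Theorem 4 (arXiv p. 5)] -/
theorem analyticPropagationOfSmallness_holds : ∀ n : ℕ, analyticPropagationOfSmallness n := by
  intro n
  rcases Nat.eq_zero_or_pos n with h | h
  · rw [h]; exact AnalyticSmallness.analyticPropagationOfSmallness_zero
  · exact AnalyticSmallness.analyticPropagationOfSmallness_of_pos h

/-- The case `n = 3` used by the Navier–Stokes tree (LINE g8-β «analytic gap» of crux `NearExtremalTransiencePerFlow`):
`analyticPropagationOfSmallness 3` holds. [cite: ApraizEscauriazaWangZhang2014, Theorem 4 (arXiv p. 5)] -/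
theorem analyticPropagationOfSmallness_three : analyticPropagationOfSmallness 3 :=
  analyticPropagationOfSmallness_holds 3

end Literature.Analysis.PDE

end
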